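/-
Copyright (c) 2026 the pub-hodgecm-mathlib formalisation cell (harness21).  Prover seat hodgecm-mathlib-LH4-p14 (g0), req620 Track A «(D-RAM) FOUR-FRAME» squad
(heir LEAD F0P3a-plan (g19) (R-17) «NI2 ⊕ MS»; dealer LH4-plan (g10) WORD #42; TARGET K of LH4-p11 (g0) (MS second seat) 22:46:06Z, cut by this seat 22:46:50Z).  2026-09-03.
-/
import Literature.NumberTheory.Automorphic.UnitaryLatticeTreeDefs   -- ★ `IsVertexLattice`, `latt`, `mapGL`, `mapGL_latt`, `formCongr`
import HarnessLib

/-!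
# Crux `H413`, line LH4 «(D-RAM) FOUR-FRAME» road — unit U3_Laws (iii), (R-17) MS ROAD A, TIER 2 SUPPORT: «DUALISABILITY IS 𝒢-INVARIANT» — a diagonal change of frame `Z = diag(z)`
# carries the type-`t` vertex lattices of `diag(D)` onto those of `diag(D∕(z·σz))` (TARGET K of the (S-fin) reduction)

Cell `hodgecm-mathlib` (D-0151), FLOOR 0, crux item H413 = `stmt-HodgeConjecture-24833`, route of record `HCCMUnconditional`; squad F0∕P3c∕LH4 (req618∕req620).  THEOREMS ONLY
(no `def`, no instance, no notation, no `sorry`, default heartbeats); lane `--supports stmt-HodgeConjecture-24833 --as helper` (count-neutral).  TARGET K of LH4-p11 (g0)'s MS ROAD-A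
list (MEMO `F0/P3c/LH4/LH4-p10/g0/MEMO-stableLaw-finite.v1.LH4p10g0.md` §2 (3): «`T(E)` acts on pairs `(D, M)` by `z·(D, M) = (D∕N(z), z·M)`»), cut announced on the squad bus
2026-09-03T22:46:50Z (Gram-matrix route, any type `t`, generic `N`).

WHAT IS PROVED (generic valued field `K`, endomorphism `σ`, any `N`, any type `t`).  For a diagonal `Z = diag(z)` with `z_i ≠ 0` and a type-`t` vertex lattice `M` of the diagonal
form `diag(D)`:  `Z·M` is a type-`t` vertex lattice of `diag(D_i·(z_i σz_i)⁻¹)` — because `Z·latt g = latt(Z g)` and the Gram matrix is unchanged: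
`(σ(Zg))ᵀ·diag(D∕(zσz))·(Zg) = (σg)ᵀ·[(σZ)ᵀ·diag(D∕(zσz))·Z]·g = (σg)ᵀ·diag(D)·g`.  Hence, for an involution `σ`, «`M` is a vertex of SOME `σ`-fixed diagonal form» is invariant
under every diagonal change of frame — in particular under `𝒢 = {diag(ϖ^{a_i}u_i)}` of the (S-fin) orbit count (3c-iii): dualisability is a property of 𝒢-orbits.
* `transpose_map_diagonal_mul_diagonal_mul_diagonal` — `(σ diag z)ᵀ·diag(D′)·diag(z) = diag(σz_i·D′_i·z_i)`.
* `formCongr_diagonal_mul_eq` — `formCongr σ (Z·g) (diag(D∕(zσz))) = formCongr σ g (diag D)`.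
* **`isVertexLattice_diagonal_mapGL_diagonal`** — TARGET K (any `t`).
* **`exists_isVertexLattice_diagonal_mapGL_diagonal_of_map_eq`** — the `σ`-fixed corollary («dualisable is 𝒢-invariant»).
HONEST LABEL.  Count-neutral; nothing printed is asserted; the census laws stay PROVER TARGETS; `HC_CM` is proved only modulo the 7 printed citations (2 remaining named inputs:
hLiu418 = `stmt-HodgeConjecture-24832`, h413 = `stmt-HodgeConjecture-24833`) until rung 0 closes.

## References
* [Jacobowitz1962] R. Jacobowitz, *Hermitian forms over local fields*, Amer. J. Math. 84 (1962), §4, §7–§8 (Gram matrices under change of basis; modular lattices).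
* [BruhatTits1972] F. Bruhat, J. Tits, *Groupes réductifs sur un corps local I*, Publ. Math. IHÉS 41 (1972), §10 (the torus action on the apartment).
* [Serre1980Trees] J.-P. Serre, *Trees*, Springer (1980), Ch. II §1.1.
-/

set_option autoImplicit false

noncomputable section

namespace Summit.HodgeConjecture.HodgeConjecture.Cruxes.H413.F0P3cDyRamDiagonalVertexTranslate

open Matrix
open Literature.NumberTheory.Automorphic Literature.NumberTheory.Automorphic.HermitianLattice
open Literature.NumberTheory.Automorphic.UnitaryLatticeTree
open scoped Valued WithZero Matrix MatrixGroups

variable {K : Type*} [Field K] {N : ℕ}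

/-- `(σ diag z)ᵀ·diag(D′)·diag(z) = diag(σz_i·D′_i·z_i)`. [cite: Jacobowitz1962, §4] -/
theorem transpose_map_diagonal_mul_diagonal_mul_diagonal (σ : K →+* K) (z D' : Fin N → K) :
    ((Matrix.diagonal z).map σ)ᵀ * Matrix.diagonal D' * Matrix.diagonal z = Matrix.diagonal fun i => σ (z i) * D' i * z i := by
  rw [Matrix.diagonal_map (map_zero σ), Matrix.diagonal_transpose, Matrix.diagonal_mul_diagonal, Matrix.diagonal_mul_diagonal]

/-- **The Gram matrix is unchanged**: `formCongr σ (Z·g) (diag(D_i·(z_iσz_i)⁻¹)) = formCongr σ g (diag D)` for `Z = diag(z)`, `z_i ≠ 0`. [cite: Jacobowitz1962, §4] -/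
theorem formCongr_diagonal_mul_eq (σ : K →+* K) (D z : Fin N → K) (hz : ∀ i, z i ≠ 0) (Z g : GL (Fin N) K)
    (hZ : (Z : Matrix (Fin N) (Fin N) K) = Matrix.diagonal z) :
    formCongr σ (Z * g) (Matrix.diagonal fun i => D i * (z i * σ (z i))⁻¹) = formCongr σ g (Matrix.diagonal D) := by
  have hσz : ∀ i, σ (z i) ≠ 0 := fun i => (map_ne_zero σ).2 (hz i)
  have hmid : ((Matrix.diagonal z).map σ)ᵀ * Matrix.diagonal (fun i => D i * (z i * σ (z i))⁻¹) * Matrix.diagonal z = Matrix.diagonal D := by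
    rw [transpose_map_diagonal_mul_diagonal_mul_diagonal]
    congr 1
    funext i
    have h1 := hz i
    have h2 := hσz i
    field_simp
  rw [formCongr, formCongr, Units.val_mul, hZ, Matrix.map_mul, Matrix.transpose_mul]
  calc ((g : Matrix (Fin N) (Fin N) K).map σ)ᵀ * ((Matrix.diagonal z).map σ)ᵀ * Matrix.diagonal (fun i => D i * (z i * σ (z i))⁻¹) *
        (Matrix.diagonal z * (g : Matrix (Fin N) (Fin N) K))
      = ((g : Matrix (Fin N) (Fin N) K).map σ)ᵀ * (((Matrix.diagonal z).map σ)ᵀ * Matrix.diagonal (fun i => D i * (z i * σ (z i))⁻¹) * Matrix.diagonal z) *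
          (g : Matrix (Fin N) (Fin N) K) := by simp only [Matrix.mul_assoc]
    _ = ((g : Matrix (Fin N) (Fin N) K).map σ)ᵀ * Matrix.diagonal D * (g : Matrix (Fin N) (Fin N) K) := by rw [hmid]

variable [Valued K ℤᵐ⁰]

/-- **«DUALISABILITY IS 𝒢-INVARIANT» (TARGET K), vertex form.**  For `Z = diag(z)` (`z_i ≠ 0`) and a type-`t` vertex lattice `M` of `diag(D)`, the translate `Z·M` is a type-`t`
vertex lattice of `diag(D_i·(z_iσz_i)⁻¹)`: `Z·latt g = latt(Zg)` (★ `mapGL_latt`) with the SAME Gram matrix (`formCongr_diagonal_mul_eq`), so the three conditions of ★ `IsVertexLattice`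
(integral Gram, `ϖ·Gram⁻¹` integral, `|det| = |ϖ|^t`) carry over verbatim. [cite: Jacobowitz1962, §7–§8] [cite: BruhatTits1972, §10] -/
theorem isVertexLattice_diagonal_mapGL_diagonal {K : Type*} [Field K] [Valued K ℤᵐ⁰] {N : ℕ} (σ : K →+* K) (ϖ : K) (D z : Fin N → K) (hz : ∀ i, z i ≠ 0)
    (Z : GL (Fin N) K) (hZ : (Z : Matrix (Fin N) (Fin N) K) = Matrix.diagonal z) {t : ℕ} {M : Submodule 𝒪[K] (Fin N → K)}
    (hM : IsVertexLattice σ ϖ (Matrix.diagonal D) t M) : IsVertexLattice σ ϖ (Matrix.diagonal fun i => D i * (z i * σ (z i))⁻¹) t (mapGL Z M) := by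
  obtain ⟨g, rfl, hint, hinv, hdet⟩ := hM
  refine ⟨Z * g, mapGL_latt Z g, ?_, ?_, ?_⟩
  · rw [formCongr_diagonal_mul_eq σ D z hz Z g hZ]; exact hint
  · rw [formCongr_diagonal_mul_eq σ D z hz Z g hZ]; exact hinv
  · rw [formCongr_diagonal_mul_eq σ D z hz Z g hZ]; exact hdet

/-- **«DUALISABILITY IS 𝒢-INVARIANT», `σ`-fixed corollary**: for an involution `σ`, if `M` is a type-`t` vertex lattice of SOME `σ`-fixed diagonal form then so is every diagonal translate
`Z·M` (`Z = diag(z)`, `z_i ≠ 0`) — with the `σ`-fixed form `diag(D_i·(z_iσz_i)⁻¹)`.  In the (S-fin) orbit count (3c-iii) this says «dualisable» is a property of the `𝒢`-orbit,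
`𝒢 = {diag(ϖ^{a_i}u_i)}`. [cite: Jacobowitz1962, §7–§8] [cite: BruhatTits1972, §10] -/
theorem exists_isVertexLattice_diagonal_mapGL_diagonal_of_map_eq {K : Type*} [Field K] [Valued K ℤᵐ⁰] {N : ℕ} {σ : K →+* K} (hσσ : ∀ a, σ (σ a) = a) (ϖ : K)
    (z : Fin N → K) (hz : ∀ i, z i ≠ 0) (Z : GL (Fin N) K) (hZ : (Z : Matrix (Fin N) (Fin N) K) = Matrix.diagonal z) {t : ℕ} {M : Submodule 𝒪[K] (Fin N → K)}
    (h : ∃ D : Fin N → K, (∀ i, σ (D i) = D i) ∧ IsVertexLattice σ ϖ (Matrix.diagonal D) t M) :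
    ∃ D' : Fin N → K, (∀ i, σ (D' i) = D' i) ∧ IsVertexLattice σ ϖ (Matrix.diagonal D') t (mapGL Z M) := by
  obtain ⟨D, hD, hM⟩ := h
  refine ⟨fun i => D i * (z i * σ (z i))⁻¹, fun i => ?_, isVertexLattice_diagonal_mapGL_diagonal σ ϖ D z hz Z hZ hM⟩
  rw [map_mul, map_inv₀, map_mul, hσσ, hD i, mul_comm (σ (z i)) (z i)]

end Summit.HodgeConjecture.HodgeConjecture.Cruxes.H413.F0P3cDyRamDiagonalVertexTranslate

end
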